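import Literature.Analysis.Complex.RectangleNested
import Mathlib.Analysis.SpecialFunctions.Integrability.Basic
import Mathlib.MeasureTheory.Integral.DominatedConvergence
import HarnessLib

/-!
# Rectangle contours with horizontal slits: strip decompositions and the collapse onto a cut

Topic `Literature/Analysis/Complex` (support for contour-shift arguments with algebraic branch
points: the Selberg–Delange method, Montgomery 1983 §4). Everything here is PROVED; no named facts.

The tree has Cauchy–Goursat and Cauchy's formula for rectangles in the four-term convention
`rectBoundaryIntegral F a b c d = bottom − top + i·right − i·left`
(`Literature/Analysis/Complex/ArgumentPrincipleRectangle.lean`, `RectangleCauchyFormula.lean`).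
For an integrand holomorphic on a rectangle EXCEPT along finitely many horizontal slits
`{x + ih : x ≤ ξ}` ending at branch points `ξ + ih` of algebraic type `(s − ξ − ih)^{−μ}`, `μ < 1`
(as `ζ(s)^μ` in the zero-free region slit along `(−∞, 1]`), the boundary integral equals the sum
of the integrals of the JUMPS across the slits:

* (from `RectangleNested.lean`: `rectBoundaryIntegral_split_im` / `_split_re` — additivity of
  the boundary integral under cutting the rectangle by a horizontal / vertical line);
* `tendsto_rectBoundaryIntegral_slitBox` — **collapse onto the cut**: for the thin boxes
  `[a, ξ + ρ] × [h − ρ, h + ρ]` around a slit, as `ρ → 0⁺` the boundary integral tends to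
  `∫_a^ξ (F₋ − F₊)`, `F∓` the boundary values from below/above, provided
  `‖F(s)‖ ≤ C ‖s − (ξ + ih)‖^{−μ}` near the slit with `μ < 1` (dominated convergence on the two
  long edges; the short edges have length `2ρ` and carry `O(ρ^{1−μ}) → 0`);
* `rectBoundaryIntegral_eq_slitIntegral` — one slit inside a rectangle on which `F` is otherwise
  holomorphic: `∮_{∂R} F = ∫_a^ξ (F₋ − F₊)`;
* `rectBoundaryIntegral_eq_sum_slitIntegral` — finitely many slits at distinct heights:
  `∮_{∂R} F = ∑_h ∫_a^ξ (F₋ʰ − F₊ʰ)` (induction on the lowest slit).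

This is the contour bookkeeping of "we replace the path of integration by a new path … consisting of
loops `Γ_k` around the points `1 − s + ik`" (Montgomery 1983, §4, between (20) and (21)) and of the
Hankel contour in Tenenbaum's proof of the Selberg–Delange theorem (II.5 §5.2), in the case of
exponents of real part `< 1`, where the small circle around the branch point carries no mass.

## References

* [Montgomery1983] H. L. Montgomery, *Zeros of approximations to the zeta function*, Studies in
  Pure Mathematics (Birkhäuser 1983), 497–506, §4.
* [Tenenbaum2015] G. Tenenbaum, *Introduction to analytic and probabilistic number theory*, 3rd
  ed., AMS GSM 163, II.5 §5.2 (proof of Thm. 5.2: the truncated Hankel contour).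
-/

noncomputable section

open Complex Set MeasureTheory Filter Topology intervalIntegral

namespace Literature.Analysis.Complex

variable {F : ℂ → ℂ} {a b c d : ℝ}

/-! ### Integrability of edge functions with finitely many bad points -/

/-- A function bounded on `[p, q]` and continuous there except at finitely many points is interval
integrable on `[p, q]`. [folklore] -/
theorem intervalIntegrable_of_bounded_of_continuousOn_diff_finite {g : ℝ → ℂ} {p q : ℝ}
    (hpq : p ≤ q) {E : Set ℝ} (hE : E.Finite) (hg : ContinuousOn g (Icc p q \ E)) {B : ℝ}
    (hB : ∀ x ∈ Icc p q \ E, ‖g x‖ ≤ B) : IntervalIntegrable g volume p q := by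
  have hnull : volume E = 0 := hE.measure_zero volume
  -- `Icc p q ∖ E` and `Icc p q` agree up to a null set
  have hset : (Icc p q \ E : Set ℝ) =ᵐ[volume] (Icc p q : Set ℝ) := by
    rw [sdiff_ae_eq_self]
    exact measure_mono_null inter_subset_right hnull
  have hmeasS : MeasurableSet (Icc p q \ E) := measurableSet_Icc.diff hE.measurableSet
  -- measurability on `Icc p q`
  have hmeas : AEStronglyMeasurable g (volume.restrict (Icc p q)) := by
    rw [← Measure.restrict_congr_set hset]
    exact hg.aestronglyMeasurable hmeasS
  -- the bound, a.e. on `Icc p q`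
  have hbound : ∀ᵐ x ∂(volume.restrict (Icc p q)), ‖g x‖ ≤ B := by
    rw [← Measure.restrict_congr_set hset, ae_restrict_iff' hmeasS]
    exact Eventually.of_forall fun x hx ↦ hB x hx
  have hint : IntegrableOn g (Icc p q) volume :=
    IntegrableOn.of_bound measure_Icc_lt_top hmeas B hbound
  rw [intervalIntegrable_iff_integrableOn_Icc_of_le hpq]
  exact hint

/-! ### Collapse of a thin box onto a slit -/

/-- For `0 < m ≤ t ≤ M` and any real `μ`: `t^{−μ} ≤ m^{−μ} + M^{−μ}` (whatever the sign of `μ`).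
[folklore] -/
theorem rpow_neg_le_add {m t M μ : ℝ} (hm : 0 < m) (hmt : m ≤ t) (htM : t ≤ M) :
    t ^ (-μ) ≤ m ^ (-μ) + M ^ (-μ) := by
  have ht : 0 < t := hm.trans_le hmt
  have hM : 0 < M := ht.trans_le htM
  rcases le_or_gt 0 μ with hμ | hμ
  · have h1 : t ^ (-μ) ≤ m ^ (-μ) := Real.rpow_le_rpow_of_nonpos hm hmt (by linarith)
    linarith [Real.rpow_nonneg hM.le (-μ)]
  · have h1 : t ^ (-μ) ≤ M ^ (-μ) := Real.rpow_le_rpow ht.le htM (by linarith)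
    linarith [Real.rpow_nonneg hm.le (-μ)]

/-- `max |u| |v| ≤ ‖u + vi‖ ≤ |u| + |v|`. [folklore] -/
theorem abs_le_norm_add_mul_I (u v : ℝ) :
    |u| ≤ ‖(u : ℂ) + v * I‖ ∧ |v| ≤ ‖(u : ℂ) + v * I‖ ∧ ‖(u : ℂ) + v * I‖ ≤ |u| + |v| := by
  have hre : ((u : ℂ) + v * I).re = u := by simp
  have him : ((u : ℂ) + v * I).im = v := by simp
  refine ⟨?_, ?_, ?_⟩
  · simpa [hre] using abs_re_le_norm ((u : ℂ) + v * I)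
  · simpa [him] using abs_im_le_norm ((u : ℂ) + v * I)
  · simpa [hre, him] using norm_le_abs_re_add_abs_im ((u : ℂ) + v * I)

/-- Real and imaginary parts of `x + yi` for real `x`, `y`. [folklore] -/
theorem re_ofReal_add_ofReal_mul_I (x y : ℝ) : ((x : ℂ) + (y : ℂ) * I).re = x := by simp

/-- Real and imaginary parts of `x + yi` for real `x`, `y`. [folklore] -/
theorem im_ofReal_add_ofReal_mul_I (x y : ℝ) : ((x : ℂ) + (y : ℂ) * I).im = y := by simp

/-- `‖(x + yi) − (ξ + hi)‖ = ‖(x − ξ) + (y − h)i‖`. [folklore] -/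
theorem norm_pt_sub_pt (x y ξ h : ℝ) :
    ‖((x : ℂ) + (y : ℂ) * I) - ((ξ : ℂ) + (h : ℂ) * I)‖ = ‖((x - ξ : ℝ) : ℂ) + ((y - h : ℝ) : ℂ) * I‖ := by
  congr 1; push_cast; ring

/-- **Collapse of a thin box onto a slit.** Let `F` be continuous on the closed box
`[a, ξ + r] × [h − r, h + r]` minus the slit `{x + ih : x ≤ ξ}`, with
`‖F(s)‖ ≤ C ‖s − (ξ + ih)‖^{−μ}` there for some `μ < 1`, and with boundary values `F₋(x)`, `F₊(x)`
from below / above at the points `x + ih`, `a ≤ x < ξ`, of the slit. Then the boundary integrals of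
the thin boxes `[a, ξ + ρ] × [h − ρ, h + ρ]` converge, as `ρ → 0⁺`, to the integral of the jump:
`∮ F → ∫_a^ξ F₋ − ∫_a^ξ F₊`. (The short edges have length `2ρ` and carry `O(ρ^{1−μ}) + O(ρ)`; on the
long edges dominated convergence applies with the integrable majorant `C(ξ − x)^{−μ} + const`.)
[cite: Tenenbaum2015, II.5 §5.2 (proof of Thm. 5.2)] -/
theorem tendsto_rectBoundaryIntegral_slitBox {F : ℂ → ℂ} {a ξ h r C μ : ℝ} (haξ : a < ξ)
    (hr : 0 < r) (hμ : μ < 1) (hC : 0 ≤ C)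
    (hcont : ContinuousOn F ({z : ℂ | a ≤ z.re ∧ z.re ≤ ξ + r ∧ |z.im - h| ≤ r} \
      {z : ℂ | z.im = h ∧ z.re ≤ ξ}))
    (hbound : ∀ z ∈ ({z : ℂ | a ≤ z.re ∧ z.re ≤ ξ + r ∧ |z.im - h| ≤ r} \
      {z : ℂ | z.im = h ∧ z.re ≤ ξ}), ‖F z‖ ≤ C * ‖z - ((ξ : ℂ) + (h : ℂ) * I)‖ ^ (-μ))
    {Fm Fp : ℝ → ℂ}
    (hlower : ∀ x ∈ Ico a ξ, Tendsto F (𝓝[{z : ℂ | z.im < h}] ((x : ℂ) + (h : ℂ) * I)) (𝓝 (Fm x)))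
    (hupper : ∀ x ∈ Ico a ξ, Tendsto F (𝓝[{z : ℂ | h < z.im}] ((x : ℂ) + (h : ℂ) * I)) (𝓝 (Fp x))) :
    Tendsto (fun ρ : ℝ ↦ rectBoundaryIntegral F a (ξ + ρ) (h - ρ) (h + ρ)) (𝓝[>] 0)
      (𝓝 ((∫ x in a..ξ, Fm x) - ∫ x in a..ξ, Fp x)) := by
  -- notation for the region and basic membership facts
  set S : Set ℂ := {z : ℂ | a ≤ z.re ∧ z.re ≤ ξ + r ∧ |z.im - h| ≤ r} \
    {z : ℂ | z.im = h ∧ z.re ≤ ξ} with hS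
  have memS : ∀ {x y : ℝ}, a ≤ x → x ≤ ξ + r → |y - h| ≤ r → ¬(y = h ∧ x ≤ ξ) →
      ((x : ℂ) + (y : ℂ) * I) ∈ S := by
    intro x y h1 h2 h3 h4
    rw [hS, Set.mem_sdiff, mem_setOf_eq, mem_setOf_eq, re_ofReal_add_ofReal_mul_I,
      im_ofReal_add_ofReal_mul_I]
    exact ⟨⟨h1, h2, h3⟩, h4⟩
  have hev : ∀ᶠ ρ in 𝓝[>] (0 : ℝ), ρ ∈ Ioo 0 r := Ioo_mem_nhdsGT hr
  -- points on the horizontal edges `y = h ± ρ`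
  have memS_horiz : ∀ {ρ : ℝ}, ρ ∈ Ioo 0 r → ∀ {x y : ℝ}, a ≤ x → x ≤ ξ + ρ →
      (y = h + ρ ∨ y = h - ρ) → ((x : ℂ) + (y : ℂ) * I) ∈ S := by
    intro ρ hρ x y hax hxρ hy
    refine memS hax (by linarith [hρ.2]) ?_ ?_
    · rcases hy with rfl | rfl
      · rw [show h + ρ - h = ρ by ring, abs_of_pos hρ.1]; exact hρ.2.le
      · rw [show h - ρ - h = -ρ by ring, abs_neg, abs_of_pos hρ.1]; exact hρ.2.le
    · rintro ⟨hyh, -⟩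
      rcases hy with rfl | rfl <;> linarith [hρ.1]
  -- points on the right edge
  have memS_right : ∀ {ρ : ℝ}, ρ ∈ Ioo 0 r → ∀ {y : ℝ}, |y - h| ≤ ρ →
      (((ξ + ρ : ℝ) : ℂ) + (y : ℂ) * I) ∈ S := by
    intro ρ hρ y hy
    refine memS (by linarith [hρ.1]) (by linarith [hρ.2]) (hy.trans hρ.2.le) ?_
    rintro ⟨-, h2⟩; linarith [hρ.1]
  -- points on the left edge, off the slit
  have memS_left : ∀ {y : ℝ}, |y - h| ≤ r → y ≠ h → ((a : ℂ) + (y : ℂ) * I) ∈ S := by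
    intro y hy hyh
    exact memS le_rfl (by linarith) hy (fun hh ↦ hyh hh.1)
  -- continuity of `F` along a horizontal segment inside `S`
  have cont_horiz : ∀ {ρ : ℝ}, ρ ∈ Ioo 0 r → ∀ {y : ℝ}, (y = h + ρ ∨ y = h - ρ) →
      ContinuousOn (fun x : ℝ ↦ F ((x : ℂ) + (y : ℂ) * I)) (Icc a (ξ + ρ)) := by
    intro ρ hρ y hy x hx
    have hmem := memS_horiz hρ hx.1 hx.2 hy
    have h1 : ContinuousAt (fun x' : ℝ ↦ (x' : ℂ) + (y : ℂ) * I) x := by fun_prop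
    exact ContinuousWithinAt.comp (g := F) (f := fun x' : ℝ ↦ (x' : ℂ) + (y : ℂ) * I)
      (hcont _ hmem) h1.continuousWithinAt (fun x' hx' ↦ memS_horiz hρ hx'.1 hx'.2 hy)
  have int_horiz : ∀ {ρ : ℝ}, ρ ∈ Ioo 0 r → ∀ {y : ℝ}, (y = h + ρ ∨ y = h - ρ) → ∀ {p q : ℝ},
      a ≤ p → p ≤ q → q ≤ ξ + ρ →
      IntervalIntegrable (fun x : ℝ ↦ F ((x : ℂ) + (y : ℂ) * I)) volume p q := by
    intro ρ hρ y hy p q hp hpq hq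
    refine ((cont_horiz hρ hy).mono ?_).intervalIntegrable
    rw [uIcc_of_le hpq]
    exact Icc_subset_Icc hp hq
  ------------------------------------------------------------------
  -- (1) the long edges: dominated convergence on `[a, ξ]`
  ------------------------------------------------------------------
  set bound : ℝ → ℝ := fun x ↦ C * ((ξ - x) ^ (-μ) + (ξ - a + r) ^ (-μ)) with hbound_def
  have bound_int : IntervalIntegrable bound volume a ξ := by
    have h1 : IntervalIntegrable (fun x : ℝ ↦ (ξ - x) ^ (-μ)) volume a ξ := by
      have := (intervalIntegral.intervalIntegrable_rpow' (a := ξ - a) (b := ξ - ξ)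
        (by linarith : -1 < -μ)).comp_sub_left ξ
      simpa using this
    exact (h1.add intervalIntegrable_const).const_mul C
  -- the bound on the long edges, for `a < x < ξ`
  have edge_bound : ∀ {ρ : ℝ}, ρ ∈ Ioo 0 r → ∀ {y : ℝ}, (y = h + ρ ∨ y = h - ρ) → ∀ {x : ℝ},
      x ∈ Ioo a ξ → ‖F ((x : ℂ) + (y : ℂ) * I)‖ ≤ bound x := by
    intro ρ hρ y hy x hx
    have hmem := memS_horiz hρ hx.1.le (by linarith [hx.2, hρ.1]) hy
    refine (hbound _ hmem).trans ?_
    rw [hbound_def]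
    refine mul_le_mul_of_nonneg_left ?_ hC
    rw [norm_pt_sub_pt]
    have hyabs : |y - h| = ρ := by
      rcases hy with rfl | rfl
      · rw [show h + ρ - h = ρ by ring, abs_of_pos hρ.1]
      · rw [show h - ρ - h = -ρ by ring, abs_neg, abs_of_pos hρ.1]
    obtain ⟨h1, -, h3⟩ := abs_le_norm_add_mul_I (x - ξ) (y - h)
    rw [abs_of_neg (by linarith [hx.2] : x - ξ < 0)] at h1 h3
    rw [hyabs] at h3
    exact rpow_neg_le_add (by linarith [hx.2]) (by linarith) (by linarith [hx.1, hρ.2])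
  -- pointwise limits on the long edges
  have approach : ∀ {x : ℝ} {σpm : ℝ}, (σpm = 1 ∨ σpm = -1) →
      Tendsto (fun ρ : ℝ ↦ (x : ℂ) + ((h + σpm * ρ : ℝ) : ℂ) * I) (𝓝[>] 0)
        (𝓝[{z : ℂ | 0 < σpm * (z.im - h)}] ((x : ℂ) + (h : ℂ) * I)) := by
    intro x σpm hσ
    refine tendsto_nhdsWithin_of_tendsto_nhds_of_eventually_within _ ?_ ?_
    · have hc : Continuous fun ρ : ℝ ↦ (x : ℂ) + ((h + σpm * ρ : ℝ) : ℂ) * I := by fun_prop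
      have h0 := hc.tendsto 0
      simp only [mul_zero, add_zero] at h0
      exact h0.mono_left nhdsWithin_le_nhds
    · filter_upwards [self_mem_nhdsWithin] with ρ (hρ : 0 < ρ)
      simp only [im_ofReal_add_ofReal_mul_I]
      rcases hσ with rfl | rfl <;> nlinarith
  have edge_lim_lower : ∀ x ∈ Ioo a ξ, Tendsto (fun ρ : ℝ ↦ F ((x : ℂ) + ((h + (-1) * ρ : ℝ) : ℂ) * I))
      (𝓝[>] 0) (𝓝 (Fm x)) := by
    intro x hx
    refine (hlower x ⟨hx.1.le, hx.2⟩).comp ?_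
    have := approach (x := x) (σpm := -1) (Or.inr rfl)
    refine this.mono_right (nhdsWithin_mono _ fun z hz ↦ ?_)
    simp only [mem_setOf_eq] at hz ⊢; linarith
  have edge_lim_upper : ∀ x ∈ Ioo a ξ, Tendsto (fun ρ : ℝ ↦ F ((x : ℂ) + ((h + 1 * ρ : ℝ) : ℂ) * I))
      (𝓝[>] 0) (𝓝 (Fp x)) := by
    intro x hx
    refine (hupper x ⟨hx.1.le, hx.2⟩).comp ?_
    have := approach (x := x) (σpm := 1) (Or.inl rfl)
    refine this.mono_right (nhdsWithin_mono _ fun z hz ↦ ?_)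
    simp only [mem_setOf_eq] at hz ⊢; linarith
  -- dominated convergence on `[a, ξ]`
  have DCT : ∀ {σpm : ℝ} {G : ℝ → ℂ}, (σpm = 1 ∨ σpm = -1) →
      (∀ x ∈ Ioo a ξ, Tendsto (fun ρ : ℝ ↦ F ((x : ℂ) + ((h + σpm * ρ : ℝ) : ℂ) * I)) (𝓝[>] 0) (𝓝 (G x))) →
      Tendsto (fun ρ : ℝ ↦ ∫ x in a..ξ, F ((x : ℂ) + ((h + σpm * ρ : ℝ) : ℂ) * I)) (𝓝[>] 0)
        (𝓝 (∫ x in a..ξ, G x)) := by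
    intro σpm G hσ hG
    have hy : ∀ ρ : ℝ, (h + σpm * ρ = h + ρ ∨ h + σpm * ρ = h - ρ) := by
      intro ρ; rcases hσ with rfl | rfl
      · left; ring
      · right; ring
    refine intervalIntegral.tendsto_integral_filter_of_dominated_convergence bound ?_ ?_
      bound_int ?_
    · filter_upwards [hev] with ρ hρ
      refine ContinuousOn.aestronglyMeasurable ?_ measurableSet_uIoc
      rw [uIoc_of_le haξ.le]
      exact (cont_horiz hρ (hy ρ)).mono (fun x hx ↦ ⟨hx.1.le, by linarith [hx.2, hρ.1]⟩)
    · filter_upwards [hev] with ρ hρ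
      have hnull : ∀ᵐ x ∂(volume : Measure ℝ), x ≠ ξ := by
        rw [ae_iff]; simp
      filter_upwards [hnull] with x hxξ hxI
      rw [uIoc_of_le haξ.le] at hxI
      exact edge_bound hρ (hy ρ) ⟨hxI.1, lt_of_le_of_ne hxI.2 hxξ⟩
    · have hnull : ∀ᵐ x ∂(volume : Measure ℝ), x ≠ ξ := by
        rw [ae_iff]; simp
      filter_upwards [hnull] with x hxξ hxI
      rw [uIoc_of_le haξ.le] at hxI
      exact hG x ⟨hxI.1, lt_of_le_of_ne hxI.2 hxξ⟩
  have lim_bot_main := DCT (Or.inr rfl) edge_lim_lower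
  have lim_top_main := DCT (Or.inl rfl) edge_lim_upper
  ------------------------------------------------------------------
  -- (2) the short pieces are `O(ρ^{1−μ})`, `O(ρ)`
  ------------------------------------------------------------------
  set ω : ℝ → ℝ := fun ρ ↦ C * (ρ ^ (-μ) + (2 * ρ) ^ (-μ)) * (2 * ρ) with hω
  have ω_tendsto : Tendsto ω (𝓝[>] 0) (𝓝 0) := by
    have h1 : Tendsto (fun ρ : ℝ ↦ ρ ^ (1 - μ)) (𝓝[>] 0) (𝓝 0) := by
      have hc : ContinuousAt (fun ρ : ℝ ↦ ρ ^ (1 - μ)) 0 :=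
        Real.continuousAt_rpow_const 0 (1 - μ) (Or.inr (by linarith))
      have := hc.tendsto
      rw [Real.zero_rpow (by linarith)] at this
      exact this.mono_left nhdsWithin_le_nhds
    have h2 : ∀ᶠ ρ in 𝓝[>] (0 : ℝ), 2 * C * (1 + (2 : ℝ) ^ (-μ)) * ρ ^ (1 - μ) = ω ρ := by
      filter_upwards [self_mem_nhdsWithin] with ρ (hρ : 0 < ρ)
      rw [hω]; simp only
      rw [Real.mul_rpow (by norm_num) hρ.le, show (1 - μ) = -μ + 1 by ring,
        Real.rpow_add hρ, Real.rpow_one]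
      ring
    refine Tendsto.congr' h2 ?_
    simpa using h1.const_mul (2 * C * (1 + (2 : ℝ) ^ (-μ)))
  -- bound for `F` near the branch point
  have near_bound : ∀ {ρ : ℝ}, ρ ∈ Ioo 0 r → ∀ {z : ℂ}, z ∈ S → ρ ≤ ‖z - ((ξ : ℂ) + (h : ℂ) * I)‖ →
      ‖z - ((ξ : ℂ) + (h : ℂ) * I)‖ ≤ 2 * ρ → ‖F z‖ ≤ C * (ρ ^ (-μ) + (2 * ρ) ^ (-μ)) := by
    intro ρ hρ z hz h1 h2
    exact (hbound z hz).trans (mul_le_mul_of_nonneg_left (rpow_neg_le_add hρ.1 h1 h2) hC)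
  -- (2a) the tails `∫_ξ^{ξ+ρ}` of the long edges
  have tail_small : ∀ {σpm : ℝ}, (σpm = 1 ∨ σpm = -1) →
      Tendsto (fun ρ : ℝ ↦ ∫ x in ξ..ξ + ρ, F ((x : ℂ) + ((h + σpm * ρ : ℝ) : ℂ) * I)) (𝓝[>] 0) (𝓝 0) := by
    intro σpm hσ
    refine squeeze_zero_norm' ?_ ω_tendsto
    filter_upwards [hev] with ρ hρ
    have hy : (h + σpm * ρ = h + ρ ∨ h + σpm * ρ = h - ρ) := by
      rcases hσ with rfl | rfl
      · left; ring
      · right; ring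
    have hyabs : |h + σpm * ρ - h| = ρ := by
      rcases hσ with rfl | rfl
      · rw [show h + 1 * ρ - h = ρ by ring, abs_of_pos hρ.1]
      · rw [show h + -1 * ρ - h = -ρ by ring, abs_neg, abs_of_pos hρ.1]
    have hle : ‖∫ x in ξ..ξ + ρ, F ((x : ℂ) + ((h + σpm * ρ : ℝ) : ℂ) * I)‖ ≤
        C * (ρ ^ (-μ) + (2 * ρ) ^ (-μ)) * |ξ + ρ - ξ| := by
      refine intervalIntegral.norm_integral_le_of_norm_le_const fun x hx ↦ ?_
      rw [uIoc_of_le (by linarith [hρ.1])] at hx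
      refine near_bound hρ (memS_horiz hρ (by linarith [hx.1]) hx.2 hy) ?_ ?_
      · rw [norm_pt_sub_pt]
        obtain ⟨-, h2, -⟩ := abs_le_norm_add_mul_I (x - ξ) (h + σpm * ρ - h)
        rwa [hyabs] at h2
      · rw [norm_pt_sub_pt]
        obtain ⟨-, -, h3⟩ := abs_le_norm_add_mul_I (x - ξ) (h + σpm * ρ - h)
        rw [hyabs, abs_of_pos (by linarith [hx.1] : 0 < x - ξ)] at h3
        linarith [hx.2]
    refine hle.trans ?_
    rw [hω]; simp only
    rw [show ξ + ρ - ξ = ρ by ring, abs_of_pos hρ.1]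
    have h0 : 0 ≤ C * (ρ ^ (-μ) + (2 * ρ) ^ (-μ)) :=
      mul_nonneg hC (add_nonneg (Real.rpow_nonneg hρ.1.le _) (Real.rpow_nonneg (by linarith [hρ.1]) _))
    nlinarith [hρ.1]
  -- (2b) the right edge
  have right_small : Tendsto (fun ρ : ℝ ↦ ∫ y in (h - ρ)..(h + ρ), F (((ξ + ρ : ℝ) : ℂ) + (y : ℂ) * I))
      (𝓝[>] 0) (𝓝 0) := by
    refine squeeze_zero_norm' ?_ ω_tendsto
    filter_upwards [hev] with ρ hρ
    have hle : ‖∫ y in (h - ρ)..(h + ρ), F (((ξ + ρ : ℝ) : ℂ) + (y : ℂ) * I)‖ ≤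
        C * (ρ ^ (-μ) + (2 * ρ) ^ (-μ)) * |h + ρ - (h - ρ)| := by
      refine intervalIntegral.norm_integral_le_of_norm_le_const fun y hy ↦ ?_
      rw [uIoc_of_le (by linarith [hρ.1])] at hy
      have hyabs : |y - h| ≤ ρ := by rw [abs_le]; constructor <;> linarith [hy.1, hy.2]
      refine near_bound hρ (memS_right hρ hyabs) ?_ ?_
      · rw [norm_pt_sub_pt, show ξ + ρ - ξ = ρ by ring]
        obtain ⟨h1, -, -⟩ := abs_le_norm_add_mul_I ρ (y - h)
        rwa [abs_of_pos hρ.1] at h1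
      · rw [norm_pt_sub_pt, show ξ + ρ - ξ = ρ by ring]
        obtain ⟨-, -, h3⟩ := abs_le_norm_add_mul_I ρ (y - h)
        rw [abs_of_pos hρ.1] at h3
        linarith
    refine hle.trans (le_of_eq ?_)
    rw [hω]; simp only
    rw [show h + ρ - (h - ρ) = 2 * ρ by ring, abs_of_pos (by linarith [hρ.1])]
  -- (2c) the left edge: `F` is bounded there (off the slit point), jump or not
  set Bleft : ℝ := C * ((ξ - a) ^ (-μ) + (ξ - a + r) ^ (-μ)) with hBleft
  have left_bound : ∀ {y : ℝ}, |y - h| ≤ r → y ≠ h → ‖F ((a : ℂ) + (y : ℂ) * I)‖ ≤ Bleft := by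
    intro y hy hyh
    refine (hbound _ (memS_left hy hyh)).trans (mul_le_mul_of_nonneg_left ?_ hC)
    rw [norm_pt_sub_pt]
    obtain ⟨h1, -, h3⟩ := abs_le_norm_add_mul_I (a - ξ) (y - h)
    rw [abs_of_neg (by linarith : a - ξ < 0)] at h1 h3
    exact rpow_neg_le_add (by linarith) (by linarith) (by linarith)
  have left_small : Tendsto (fun ρ : ℝ ↦ ∫ y in (h - ρ)..(h + ρ), F ((a : ℂ) + (y : ℂ) * I))
      (𝓝[>] 0) (𝓝 0) := by
    have hωl : Tendsto (fun ρ : ℝ ↦ Bleft * (2 * ρ)) (𝓝[>] 0) (𝓝 0) := by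
      have hc : Continuous fun ρ : ℝ ↦ Bleft * (2 * ρ) := by fun_prop
      have := hc.tendsto 0
      rw [mul_zero, mul_zero] at this
      exact this.mono_left nhdsWithin_le_nhds
    refine squeeze_zero_norm' ?_ hωl
    filter_upwards [hev] with ρ hρ
    have hle : ‖∫ y in (h - ρ)..(h + ρ), F ((a : ℂ) + (y : ℂ) * I)‖ ≤ Bleft * |h + ρ - (h - ρ)| := by
      refine intervalIntegral.norm_integral_le_of_norm_le_const_ae ?_
      have hnull : ∀ᵐ y ∂(volume : Measure ℝ), y ≠ h := by
        rw [ae_iff]; simp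
      filter_upwards [hnull] with y hyh hy
      rw [uIoc_of_le (by linarith [hρ.1])] at hy
      exact left_bound (by rw [abs_le]; constructor <;> linarith [hy.1, hy.2, hρ.2]) hyh
    refine hle.trans (le_of_eq ?_)
    rw [show h + ρ - (h - ρ) = 2 * ρ by ring, abs_of_pos (by linarith [hρ.1])]
  ------------------------------------------------------------------
  -- (3) assemble
  ------------------------------------------------------------------
  have lim_bot : Tendsto (fun ρ : ℝ ↦ ∫ x in a..ξ + ρ, F ((x : ℂ) + ((h - ρ : ℝ) : ℂ) * I)) (𝓝[>] 0)
      (𝓝 (∫ x in a..ξ, Fm x)) := by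
    have hsum := lim_bot_main.add (tail_small (Or.inr rfl))
    rw [add_zero] at hsum
    refine hsum.congr' ?_
    filter_upwards [hev] with ρ hρ
    have e : (h + (-1) * ρ : ℝ) = h - ρ := by ring
    rw [e]
    exact integral_add_adjacent_intervals
      (int_horiz hρ (Or.inr rfl) le_rfl haξ.le (by linarith [hρ.1]))
      (int_horiz hρ (Or.inr rfl) haξ.le (by linarith [hρ.1]) le_rfl)
  have lim_top : Tendsto (fun ρ : ℝ ↦ ∫ x in a..ξ + ρ, F ((x : ℂ) + ((h + ρ : ℝ) : ℂ) * I)) (𝓝[>] 0)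
      (𝓝 (∫ x in a..ξ, Fp x)) := by
    have hsum := lim_top_main.add (tail_small (Or.inl rfl))
    rw [add_zero] at hsum
    refine hsum.congr' ?_
    filter_upwards [hev] with ρ hρ
    have e : (h + 1 * ρ : ℝ) = h + ρ := by ring
    rw [e]
    exact integral_add_adjacent_intervals
      (int_horiz hρ (Or.inl rfl) le_rfl haξ.le (by linarith [hρ.1]))
      (int_horiz hρ (Or.inl rfl) haξ.le (by linarith [hρ.1]) le_rfl)
  have := ((lim_bot.sub lim_top).add (right_small.const_mul I)).sub (left_small.const_mul I)
  simp only [mul_zero, add_zero, sub_zero] at this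
  refine this.congr' (Eventually.of_forall fun ρ ↦ ?_)
  simp only [rectBoundaryIntegral]

/-! ### One slit inside a rectangle -/

/-- Cauchy–Goursat for a closed rectangle contained in an open set on which `F` is holomorphic.
[folklore] -/
theorem rectBoundaryIntegral_eq_zero_of_subset {F : ℂ → ℂ} {a b c d : ℝ} (hab : a ≤ b)
    (hcd : c ≤ d) {V : Set ℂ} (hF : DifferentiableOn ℂ F V) (hV : Icc a b ×ℂ Icc c d ⊆ V) :
    rectBoundaryIntegral F a b c d = 0 :=
  rectBoundaryIntegral_eq_zero_of_differentiableOn hab hcd (hF.mono hV)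

/-- **A rectangle with one horizontal slit.** Let `F` be holomorphic on a neighbourhood `U` of
the closed rectangle `[a,b] × [c,d]` minus the slit `{x + ih : x ≤ ξ}` (`a < ξ < b`, `c < h < d`),
of algebraic type at the branch point: `‖F(s)‖ ≤ C ‖s − (ξ + ih)‖^{−μ}`, `μ < 1`, on the box
`[a, ξ + r] × [h − r, h + r]` minus the slit, with boundary values `F∓` from below/above along the
slit, and integrable along the left edge. Then `∮_{∂R} F = ∫_a^ξ F₋ − ∫_a^ξ F₊`: the contour collapses
onto the two rims of the slit (Cauchy–Goursat on the three slit-free sub-rectangles, and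
`tendsto_rectBoundaryIntegral_slitBox`). [cite: Tenenbaum2015, II.5 §5.2 (proof of Thm. 5.2)]
[cite: Montgomery1983, §4 (the loops Γ_k)] -/
theorem rectBoundaryIntegral_eq_slitIntegral {F : ℂ → ℂ} {a b c d ξ h r C μ : ℝ}
    (haξ : a < ξ) (hr : 0 < r) (hξr : ξ + r ≤ b) (hcr : c ≤ h - r) (hrd : h + r ≤ d)
    (hμ : μ < 1) (hC : 0 ≤ C) {U : Set ℂ} (hsub : Icc a b ×ℂ Icc c d ⊆ U)
    (hF : DifferentiableOn ℂ F (U \ {z : ℂ | z.im = h ∧ z.re ≤ ξ}))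
    (hbound : ∀ z ∈ ({z : ℂ | a ≤ z.re ∧ z.re ≤ ξ + r ∧ |z.im - h| ≤ r} \
      {z : ℂ | z.im = h ∧ z.re ≤ ξ}), ‖F z‖ ≤ C * ‖z - ((ξ : ℂ) + (h : ℂ) * I)‖ ^ (-μ))
    (hleft : IntervalIntegrable (fun y : ℝ ↦ F ((a : ℂ) + (y : ℂ) * I)) volume c d)
    {Fm Fp : ℝ → ℂ}
    (hlower : ∀ x ∈ Ico a ξ, Tendsto F (𝓝[{z : ℂ | z.im < h}] ((x : ℂ) + (h : ℂ) * I)) (𝓝 (Fm x)))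
    (hupper : ∀ x ∈ Ico a ξ, Tendsto F (𝓝[{z : ℂ | h < z.im}] ((x : ℂ) + (h : ℂ) * I)) (𝓝 (Fp x))) :
    rectBoundaryIntegral F a b c d = (∫ x in a..ξ, Fm x) - ∫ x in a..ξ, Fp x := by
  set T : Set ℂ := {z : ℂ | z.im = h ∧ z.re ≤ ξ} with hT
  have hab : a ≤ b := by linarith
  have hcd : c ≤ d := by linarith
  have hFc : ContinuousOn F (U \ T) := hF.continuousOn
  -- membership of rectangle points off the slit
  have memUT : ∀ {x y : ℝ}, x ∈ Icc a b → y ∈ Icc c d → ¬(y = h ∧ x ≤ ξ) →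
      ((x : ℂ) + (y : ℂ) * I) ∈ U \ T := by
    intro x y hx hy hne
    refine ⟨hsub ?_, ?_⟩
    · exact ⟨by simpa using hx, by simpa using hy⟩
    · simpa [hT] using hne
  -- the keyhole limit
  have hkey := tendsto_rectBoundaryIntegral_slitBox haξ hr hμ hC
    (hFc.mono (by
      rintro z ⟨⟨h1, h2, h3⟩, h4⟩
      refine ⟨hsub ⟨⟨h1, h2.trans hξr⟩, ?_⟩, h4⟩
      rw [abs_le] at h3
      exact ⟨by linarith [h3.1], by linarith [h3.2]⟩)) hbound hlower hupper
  -- for small `ρ`, the boundary integral equals the thin-box integral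
  have hev : ∀ᶠ ρ in 𝓝[>] (0 : ℝ), ρ ∈ Ioo 0 r := Ioo_mem_nhdsGT hr
  have heq : ∀ᶠ ρ in 𝓝[>] (0 : ℝ),
      rectBoundaryIntegral F a (ξ + ρ) (h - ρ) (h + ρ) = rectBoundaryIntegral F a b c d := by
    filter_upwards [hev] with ρ hρ
    have h1 : c ≤ h - ρ := by linarith [hρ.2]
    have h2 : h - ρ ≤ h + ρ := by linarith [hρ.1]
    have h3 : h + ρ ≤ d := by linarith [hρ.2]
    -- vertical edges of the full rectangle
    have hright : IntervalIntegrable (fun y : ℝ ↦ F ((b : ℂ) + (y : ℂ) * I)) volume c d :=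
      intervalIntegrable_vertical_of_continuousOn hFc b hcd
        (fun y hy ↦ memUT ⟨hab, le_rfl⟩ hy (fun hh ↦ by linarith [hh.2]))
    -- split horizontally at `h − ρ` and `h + ρ`
    rw [rectBoundaryIntegral_split_im h1 (h2.trans h3) hleft hright,
      rectBoundaryIntegral_split_im (F := F) h2 h3
        (hleft.mono_set (by rw [uIcc_of_le hcd, uIcc_of_le (h2.trans h3)]; exact Icc_subset_Icc_left h1))
        (hright.mono_set (by rw [uIcc_of_le hcd, uIcc_of_le (h2.trans h3)]; exact Icc_subset_Icc_left h1))]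
    -- the bottom and top sub-rectangles are slit-free
    have hbot0 : rectBoundaryIntegral F a b c (h - ρ) = 0 :=
      rectBoundaryIntegral_eq_zero_of_subset hab h1 hF (by
        rintro z ⟨hzre, hzim⟩
        refine memUT (x := z.re) (y := z.im) hzre ⟨hzim.1, by linarith [hzim.2]⟩
          (fun hh ↦ by linarith [hh.1, hzim.2, hρ.1]) |> fun hm ↦ by simpa using hm)
    have htop0 : rectBoundaryIntegral F a b (h + ρ) d = 0 :=
      rectBoundaryIntegral_eq_zero_of_subset hab h3 hF (by
        rintro z ⟨hzre, hzim⟩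
        refine memUT (x := z.re) (y := z.im) hzre ⟨by linarith [hzim.1], hzim.2⟩
          (fun hh ↦ by linarith [hh.1, hzim.1, hρ.1]) |> fun hm ↦ by simpa using hm)
    rw [hbot0, htop0, zero_add, add_zero]
    -- split the middle strip vertically at `ξ + ρ`
    have hstrip_bot : IntervalIntegrable (fun x : ℝ ↦ F ((x : ℂ) + ((h - ρ : ℝ) : ℂ) * I)) volume a b :=
      intervalIntegrable_horizontal_of_continuousOn hFc (h - ρ) hab
        (fun x hx ↦ memUT hx ⟨h1, by linarith⟩ (fun hh ↦ by linarith [hh.1, hρ.1]))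
    have hstrip_top : IntervalIntegrable (fun x : ℝ ↦ F ((x : ℂ) + ((h + ρ : ℝ) : ℂ) * I)) volume a b :=
      intervalIntegrable_horizontal_of_continuousOn hFc (h + ρ) hab
        (fun x hx ↦ memUT hx ⟨by linarith, h3⟩ (fun hh ↦ by linarith [hh.1, hρ.1]))
    rw [rectBoundaryIntegral_split_re (m := ξ + ρ) (by linarith [hρ.1]) (by linarith [hρ.2])
      hstrip_bot hstrip_top]
    have hright0 : rectBoundaryIntegral F (ξ + ρ) b (h - ρ) (h + ρ) = 0 :=
      rectBoundaryIntegral_eq_zero_of_subset (by linarith [hρ.2]) h2 hF (by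
        rintro z ⟨hzre, hzim⟩
        refine memUT (x := z.re) (y := z.im) ⟨by linarith [hzre.1, hρ.1], hzre.2⟩
          ⟨by linarith [hzim.1], by linarith [hzim.2]⟩
          (fun hh ↦ by linarith [hh.2, hzre.1, hρ.1]) |> fun hm ↦ by simpa using hm)
    rw [hright0, add_zero]
  -- conclude by uniqueness of limits
  have hconst : Tendsto (fun _ : ℝ ↦ rectBoundaryIntegral F a b c d) (𝓝[>] (0 : ℝ))
      (𝓝 ((∫ x in a..ξ, Fm x) - ∫ x in a..ξ, Fp x)) := hkey.congr' heq
  exact tendsto_nhds_unique tendsto_const_nhds hconst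

/-! ### Finitely many slits -/

/-- **A rectangle with finitely many horizontal slits** at heights `h ∈ H`, all ending at the
abscissa `ξ` and pairwise `2r`-separated: if `F` is holomorphic on a neighbourhood of the closed
rectangle minus the slits, of algebraic type `μ < 1` at each branch point `ξ + ih` (on the box
`[a, ξ + r] × [h − r, h + r]`), with boundary values `F∓ʰ` along each slit, and integrable along the
left edge, then `∮_{∂R} F = ∑_{h ∈ H} (∫_a^ξ F₋ʰ − ∫_a^ξ F₊ʰ)`. (Induction on the lowest slit: cut the
rectangle horizontally between it and the others.) [cite: Montgomery1983, §4 (the loops Γ_k, |k| ≤ K)]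
[cite: Tenenbaum2015, II.5 §5.2] -/
theorem rectBoundaryIntegral_eq_sum_slitIntegral (H : Finset ℝ) {F : ℂ → ℂ} {a b ξ r C μ : ℝ}
    (haξ : a < ξ) (hr : 0 < r) (hξr : ξ + r ≤ b) (hμ : μ < 1) (hC : 0 ≤ C)
    (hsep : ∀ h ∈ H, ∀ h' ∈ H, h < h' → h + 2 * r ≤ h')
    (hbound : ∀ h ∈ H, ∀ z ∈ ({z : ℂ | a ≤ z.re ∧ z.re ≤ ξ + r ∧ |z.im - h| ≤ r} \
      {z : ℂ | z.im = h ∧ z.re ≤ ξ}), ‖F z‖ ≤ C * ‖z - ((ξ : ℂ) + (h : ℂ) * I)‖ ^ (-μ))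
    {Fm Fp : ℝ → ℝ → ℂ}
    (hlower : ∀ h ∈ H, ∀ x ∈ Ico a ξ,
      Tendsto F (𝓝[{z : ℂ | z.im < h}] ((x : ℂ) + (h : ℂ) * I)) (𝓝 (Fm h x)))
    (hupper : ∀ h ∈ H, ∀ x ∈ Ico a ξ,
      Tendsto F (𝓝[{z : ℂ | h < z.im}] ((x : ℂ) + (h : ℂ) * I)) (𝓝 (Fp h x)))
    {c d : ℝ} (hH : ∀ h ∈ H, c + r ≤ h ∧ h + r ≤ d) (hcd : c ≤ d)
    {U : Set ℂ} (hsub : Icc a b ×ℂ Icc c d ⊆ U)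
    (hF : DifferentiableOn ℂ F (U \ ⋃ h ∈ H, {z : ℂ | z.im = h ∧ z.re ≤ ξ}))
    (hleft : IntervalIntegrable (fun y : ℝ ↦ F ((a : ℂ) + (y : ℂ) * I)) volume c d) :
    rectBoundaryIntegral F a b c d = ∑ h ∈ H, ((∫ x in a..ξ, Fm h x) - ∫ x in a..ξ, Fp h x) := by
  have hab : a ≤ b := by linarith
  -- induction on the lowest slit, for all `c ≤ d` and all neighbourhoods `U`
  induction H using Finset.induction_on_min generalizing c d U with
  | empty =>
    rw [Finset.sum_empty]
    refine rectBoundaryIntegral_eq_zero_of_subset hab hcd hF (fun z hz ↦ ⟨hsub hz, ?_⟩)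
    simp
  | insert h₀ H' hmin ih =>
    have hh₀ := hH h₀ (Finset.mem_insert_self _ _)
    set e : ℝ := h₀ + r with he
    have hce : c ≤ e := by linarith [hh₀.1]
    have hed : e ≤ d := hh₀.2
    have hH'sep : ∀ h' ∈ H', h₀ + 2 * r ≤ h' := fun h' hh' ↦
      hsep h₀ (Finset.mem_insert_self _ _) h' (Finset.mem_insert_of_mem hh') (hmin h' hh')
    have hh₀H' : h₀ ∉ H' := fun hm ↦ lt_irrefl _ (hmin h₀ hm)
    -- continuity off the slits and the right edge
    have hFc := hF.continuousOn
    have hright : IntervalIntegrable (fun y : ℝ ↦ F ((b : ℂ) + (y : ℂ) * I)) volume c d := by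
      refine intervalIntegrable_vertical_of_continuousOn hFc b hcd (fun y hy ↦ ⟨hsub ?_, ?_⟩)
      · exact ⟨by simpa using (⟨hab, le_rfl⟩ : b ∈ Icc a b), by simpa using hy⟩
      · simp only [mem_iUnion, mem_setOf_eq, not_exists, not_and]
        intro h' _ _
        simp; linarith
    -- split at height `e`
    rw [rectBoundaryIntegral_split_im hce hed hleft hright, Finset.sum_insert hh₀H']
    congr 1
    · -- the lower part contains the single slit `h₀`
      refine rectBoundaryIntegral_eq_slitIntegral haξ hr hξr (by linarith [hh₀.1]) (le_refl e) hμ hC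
        (U := U ∩ {z : ℂ | z.im < h₀ + 2 * r}) ?_ ?_ (hbound h₀ (Finset.mem_insert_self _ _))
        (hleft.mono_set (by rw [uIcc_of_le hcd, uIcc_of_le hce]; exact Icc_subset_Icc_right hed))
        (hlower h₀ (Finset.mem_insert_self _ _)) (hupper h₀ (Finset.mem_insert_self _ _))
      · rintro z ⟨hzre, hzim⟩
        refine ⟨hsub ⟨hzre, ⟨hzim.1, hzim.2.trans hed⟩⟩, ?_⟩
        show z.im < h₀ + 2 * r
        have := hzim.2; rw [he] at this; linarith
      · refine hF.mono ?_
        rintro z ⟨⟨hzU, hzim⟩, hzT⟩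
        refine ⟨hzU, ?_⟩
        simp only [mem_iUnion, mem_setOf_eq, not_exists, not_and, Finset.mem_insert]
        rintro h' (rfl | hh') hzh
        · exact fun hle ↦ hzT ⟨hzh, hle⟩
        · have := hH'sep h' hh'
          have hzim' : z.im < h₀ + 2 * r := hzim
          intro _; linarith
    · -- the upper part: induction hypothesis
      refine ih
        (fun h hh h' hh' hlt ↦ hsep h (Finset.mem_insert_of_mem hh) h' (Finset.mem_insert_of_mem hh') hlt)
        (fun h hh ↦ hbound h (Finset.mem_insert_of_mem hh))
        (fun h hh ↦ hlower h (Finset.mem_insert_of_mem hh))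
        (fun h hh ↦ hupper h (Finset.mem_insert_of_mem hh))
        (fun h' hh' ↦ ⟨by have := hH'sep h' hh'; rw [he]; linarith,
          (hH h' (Finset.mem_insert_of_mem hh')).2⟩) hed
        (U := U ∩ {z : ℂ | h₀ < z.im}) ?_ ?_
        (hleft.mono_set (by rw [uIcc_of_le hcd, uIcc_of_le hed]; exact Icc_subset_Icc_left hce))
      · rintro z ⟨hzre, hzim⟩
        refine ⟨hsub ⟨hzre, ⟨hce.trans hzim.1, hzim.2⟩⟩, ?_⟩
        show h₀ < z.im
        have := hzim.1; rw [he] at this; linarith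
      · refine hF.mono ?_
        rintro z ⟨⟨hzU, hzim⟩, hzT⟩
        refine ⟨hzU, ?_⟩
        simp only [mem_iUnion, mem_setOf_eq, not_exists, not_and, Finset.mem_insert]
        rintro h' (rfl | hh') hzh
        · have hzim' : h' < z.im := hzim
          intro _; linarith
        · intro hle
          apply hzT
          simp only [mem_iUnion, mem_setOf_eq]
          exact ⟨h', hh', hzh, hle⟩

end Literature.Analysis.Complex

end
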